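import Summits.KontsevichZagierPeriods.KontsevichZagierPeriods.Theses.SymplecticScissors
import Summits.KontsevichZagierPeriods.KontsevichZagierPeriods.Theorems.PlanarK0Injective.Negative.Horn
import Summits.KontsevichZagierPeriods.KontsevichZagierPeriods.Theorems.SymplecticScissorsPlanarCompilerGreenAux1
import Summits.KontsevichZagierPeriods.KontsevichZagierPeriods.Theorems.SymplecticScissorsStackingShear
import Summits.KontsevichZagierPeriods.KontsevichZagierPeriods.Theorems.GammaHodgeSector.Negative.Algebraicity
import Literature.NumberTheory.Transcendental.KZGroundingRelations
import Literature.NumberTheory.Transcendental.KZSemialgebraicComplex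

/-!
# `PlanarK0Injective` (stmt-KontsevichZagierPeriods-9847) — line `mordell-weil-normal-form`,
stub `stub_cellReading`

READING a planar set as standard cells, inside the planar set-chain group (rules 1a and 2 only):
(A) cut at `|x| = 1` and compactify `{|x| > 1}` by the horn map `(x, y) ↦ (1/x, x²y)` (`stepA`);
(B) cylindrical decomposition adapted to the set, cut along the cylinders, discard null cells and
graphs, keep the inner bands (`brd`); (C) over a cell, the two sections of a band are `C^∞` off a
null `ℚ`-semialgebraic set (`KZ.exists_isOpen_contDiffOn`); a second decomposition adapted to the
smooth locus cuts the band into null pieces and smooth bands over intervals with algebraic ends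
(`level_one`); (D) such a band is sheared down by its lower section and renormalised by the affine
symplectic map `((x − a)/(b − a), (b − a) y)` onto a standard cell over `(0, 1)` (`sbb`).
[Kontsevich–Zagier 2001, §1.2; Basu–Pollack–Roy 2006, Cor. 5.7; folklore]
-/

noncomputable section

open MeasureTheory Set
open scoped ContDiff
open Literature.NumberTheory.Transcendental Literature.ModelTheory.ExponentialFields
open Summit.KontsevichZagierPeriods.SymplecticScissors.PlanarK0InjectiveNegative
open Summit.KontsevichZagierPeriods.SymplecticScissors.PlanarCompilerProof

namespace Summit.KontsevichZagierPeriods.SymplecticScissors.MordellWeil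

section SC
variable {α : Type*} {P : α → Prop} {F : α → KZ.FormalRep}

/-- Finite-sum bookkeeping modulo `planarGroup`: transfer along a congruence. [folklore] -/
private theorem sc_congr {x y : KZ.FormalRep} (h : y - x ∈ planarGroup)
    (hx : ∃ L : List α, (∀ a ∈ L, P a) ∧ x - (L.map F).sum ∈ planarGroup) :
    ∃ L : List α, (∀ a ∈ L, P a) ∧ y - (L.map F).sum ∈ planarGroup := by
  obtain ⟨L, hL, hx⟩ := hx; exact ⟨L, hL, by convert add_mem h hx using 1; abel⟩

/-- Finite-sum bookkeeping modulo `planarGroup`: concatenation. [folklore] -/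
private theorem sc_add {x y : KZ.FormalRep} (hx : ∃ L : List α, (∀ a ∈ L, P a) ∧ x - (L.map F).sum ∈ planarGroup)
    (hy : ∃ L : List α, (∀ a ∈ L, P a) ∧ y - (L.map F).sum ∈ planarGroup) :
    ∃ L : List α, (∀ a ∈ L, P a) ∧ x + y - (L.map F).sum ∈ planarGroup := by
  obtain ⟨L₁, h₁, e₁⟩ := hx; obtain ⟨L₂, h₂, e₂⟩ := hy
  exact ⟨L₁ ++ L₂, List.forall_mem_append.2 ⟨h₁, h₂⟩, by rw [List.map_append, List.sum_append]; convert add_mem e₁ e₂ using 1; abel⟩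

/-- Finite-sum bookkeeping modulo `planarGroup`: the empty list. [folklore] -/
private theorem sc_zero {x : KZ.FormalRep} (hx : x ∈ planarGroup) :
    ∃ L : List α, (∀ a ∈ L, P a) ∧ x - (L.map F).sum ∈ planarGroup := ⟨[], by simp, by simpa using hx⟩

/-- Finite-sum bookkeeping modulo `planarGroup`: finite sums. [folklore] -/
private theorem sc_sum {ι : Type*} (s : Finset ι) (x : ι → KZ.FormalRep)
    (h : ∀ i ∈ s, ∃ L : List α, (∀ a ∈ L, P a) ∧ x i - (L.map F).sum ∈ planarGroup) :
    ∃ L : List α, (∀ a ∈ L, P a) ∧ (∑ i ∈ s, x i) - (L.map F).sum ∈ planarGroup :=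
  Finset.sum_induction x (fun y => ∃ L : List α, (∀ a ∈ L, P a) ∧ y - (L.map F).sum ∈ planarGroup) (fun _ _ => sc_add) (sc_zero (zero_mem _)) h

end SC

/-- Tonelli for a subgraph `{x ∈ T, 0 < y < g x}`: its area is `∫⁻_T g`. [folklore] -/
private theorem volume_cell {T : Set ℝ} (hT : MeasurableSet T) {g : ℝ → ℝ} (hg : AEMeasurable g (volume.restrict T)) :
    volume {p : Fin 2 → ℝ | p 0 ∈ T ∧ 0 < p 1 ∧ p 1 < g (p 0)} = ∫⁻ t in T, ENNReal.ofReal (g t) := by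
  have h := (volume_preserving_finTwoArrow ℝ).measure_preimage_equiv (regionBetween (fun _ => 0) g T)
  rw [Measure.volume_eq_prod, volume_regionBetween_eq_lintegral aemeasurable_const hg hT] at h
  convert h using 2; (· ext p; simp [regionBetween, MeasurableEquiv.finTwoArrow]); simp

/-- **Rule 2 with `|det| = 1` inside the planar sets.** A `ℚ`-semialgebraic injective map,
differentiable within the domain with `|det| = 1`, carries a planar integrand-`1` representation to
the integrand-`1` representation on the image (finite area by the Jacobian formula), in
`planarGroup`. [Kontsevich–Zagier 2001, §1.2, rule (2)] -/
private theorem cov_move (r : KZ.IntegralRep 2) (hr1 : ∀ p ∈ r.domain, r.integrand p = 1)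
    {Φ : (Fin 2 → ℝ) → Fin 2 → ℝ} {Φ' : (Fin 2 → ℝ) → (Fin 2 → ℝ) →L[ℝ] Fin 2 → ℝ} (hsa : IsSemialgebraicMapOn ℚ r.domain Φ)
    (hd : ∀ p ∈ r.domain, HasFDerivWithinAt Φ (Φ' p) r.domain p) (hinj : InjOn Φ r.domain)
    (hdet : ∀ p ∈ r.domain, |(Φ' p).det| = 1) :
    ∃ r' : KZ.IntegralRep 2, r'.domain = Φ '' r.domain ∧ (r'.integrand = fun _ => 1) ∧ KZ.of r - KZ.of r' ∈ planarGroup := by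
  have hm := KZ.IntegralRep.measurableSet_domain_holds r
  have hfin : volume (Φ '' r.domain) ≠ ⊤ := by
    rw [← lintegral_abs_det_fderiv_eq_addHaar_image volume hm hd hinj, setLIntegral_congr_fun hm fun p hp => by rw [hdet p hp]]
    simpa using KZ.volume_ne_top_of_integrand_one r hr1
  obtain ⟨r', h1, h2⟩ := KZ.exists_oneRep (IsSemialgebraicMapOn.isSemialgebraic_image_holds hsa Subset.rfl r.isSemialgebraic_domain) hfin
  exact ⟨r', h1, h2, of_sub_of_mem_planarGroup_of_cov hr1 (fun p _ => by rw [h2])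
    ⟨2, r, r', Φ, Φ', hsa, hd, hinj, h1, fun p hp => by rw [hr1 p hp, h2, hdet p hp]; simp, rfl⟩⟩

/-- **Step (A).** `[r] ≡ [r ∩ {|x| ≤ 1}] + [horn image of r ∩ {|x| > 1}]`, both pieces planar with
integrand `1` inside the slab `{|x| ≤ 1}` (one cut, one move `(x, y) ↦ (1/x, x²y)`). [folklore] -/
private theorem stepA (r : KZ.IntegralRep 2) (hr1 : ∀ p ∈ r.domain, r.integrand p = 1) :
    ∃ r₁ r₂ : KZ.IntegralRep 2, (∀ p ∈ r₁.domain, r₁.integrand p = 1) ∧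
      (∀ p ∈ r₂.domain, r₂.integrand p = 1) ∧ (∀ p ∈ r₁.domain, p 0 ∈ Icc (-1:ℝ) 1) ∧
      (∀ p ∈ r₂.domain, p 0 ∈ Icc (-1:ℝ) 1) ∧ KZ.of r - KZ.of r₁ - KZ.of r₂ ∈ planarGroup := by
  have hI : IsSemialgebraic ℚ {p : Fin 2 → ℝ | p 0 ∈ Icc (-1:ℝ) 1} := by simpa using isSemialgebraic_coord_Icc 0 (-1) 1
  have e1 := of_sub_of_restrict_sub_of_restrict_mem_planarGroup r hr1 (r.isSemialgebraic_domain.inter hI) inter_subset_left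
  set r₁ := r.restrict (r.domain ∩ _) (r.isSemialgebraic_domain.inter hI) inter_subset_left
  set e₂ := r.restrict (r.domain \ _) (r.isSemialgebraic_domain.diff (r.isSemialgebraic_domain.inter hI)) sdiff_subset
  have he₂1 : ∀ p ∈ e₂.domain, e₂.integrand p = 1 := fun p hp => hr1 p hp.1
  have habs : ∀ p ∈ e₂.domain, 1 < |p 0| := fun p hp => by
    have h : ¬ (p 0 ∈ Icc (-1:ℝ) 1) := fun h => hp.2 ⟨hp.1, h⟩
    rwa [mem_Icc, ← abs_le, not_le] at h
  have hne : ∀ p ∈ e₂.domain, p 0 ≠ 0 := fun p hp h0 => by linarith [h0 ▸ habs p hp, abs_zero (α := ℝ)]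
  have hsa : IsSemialgebraicMapOn ℚ e₂.domain hornMap := by
    have hs := e₂.isSemialgebraic_domain
    refine IsSemialgebraicMapOn.of_forall hs (Fin.forall_fin_two.2 ⟨?_, ?_⟩)
    · exact ((isSemialgebraicFunOn_apply hs 0).inv hne).congr fun p _ => by simp [hornMap]
    · exact (isSemialgebraicFunOn_aeval hs (MvPolynomial.X 0 ^ 2 * MvPolynomial.X 1)).congr fun p _ => by simp [hornMap]
  have hinj : InjOn hornMap e₂.domain := by
    intro p _ q hq h
    have h0 : p 0 = q 0 := inv_inj.1 (by simpa [hornMap] using congrFun h 0)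
    have h1 : q 0 ^ 2 * p 1 = q 0 ^ 2 * q 1 := by simpa [hornMap, h0] using congrFun h 1
    ext i; fin_cases i; exacts [h0, mul_left_cancel₀ (pow_ne_zero 2 (hne q hq)) h1]
  obtain ⟨r₂, hr₂d, hr₂i, e4⟩ := cov_move e₂ he₂1 hsa (fun p hp => (hasFDerivAt_hornMap (hne p hp)).hasFDerivWithinAt)
    hinj (fun p hp => by rw [det_hornMapDeriv (hne p hp)]; simp)
  refine ⟨r₁, r₂, fun p hp => hr1 p hp.1, fun p _ => by rw [hr₂i], fun p hp => hp.2, fun q hq => ?_, ?_⟩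
  · rw [hr₂d] at hq
    obtain ⟨p, hp, rfl⟩ := hq
    show (p 0)⁻¹ ∈ Icc (-1) 1
    rw [mem_Icc, ← abs_le, abs_inv]; exact (inv_lt_one_of_one_lt₀ (habs p hp)).le
  · simpa using add_mem e1 e4

/-- **Cells of the line.** A cell of positive measure of a cylindrical decomposition of `ℝ¹`
inside the slab `[-1, 1]` is an open interval with algebraic end points (an inner band over `ℝ⁰`;
its ends are `ℚ`-semialgebraic points). [Basu–Pollack–Roy 2006, Def. 5.1; folklore] -/
private theorem level_one {𝒯 : Finset (Set (Fin 1 → ℝ))} (h𝒯 : IsCylindricalDecomposition ℚ 1 𝒯)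
    {T : Set (Fin 1 → ℝ)} (hT : T ∈ 𝒯) (h0 : volume T ≠ 0) (hsub : T ⊆ {z | z 0 ∈ Icc (-1:ℝ) 1}) :
    ∃ a b : ℝ, a < b ∧ IsAlgebraic ℚ a ∧ IsAlgebraic ℚ b ∧ T = {z | z 0 ∈ Ioo a b} := by
  obtain ⟨-, hsa, 𝒮₀, h𝒮₀, l, ξ, -, -, hmono, hmem⟩ := h𝒯
  obtain ⟨S, hS, hT'⟩ := (hmem T).1 hT
  obtain rfl : S = univ := by simpa [isCylindricalDecomposition_zero.1 h𝒮₀] using hS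
  set e₀ : Fin 0 → ℝ := Fin.elim0
  have hinit : ∀ z : Fin 1 → ℝ, Fin.init z = e₀ := fun z => Subsingleton.elim _ _
  have hgraph : ∀ i, graphOver univ (ξ univ i) = {fun _ => ξ univ i e₀} := fun i => by
    ext z; rw [mem_graphOver_iff, hinit, mem_singleton_iff]
    exact ⟨fun h => funext fun k => by rw [Fin.eq_zero k]; exact h.2, fun h => ⟨mem_univ _, by rw [h]⟩⟩
  have halg : ∀ i, IsAlgebraic ℚ (ξ univ i e₀) := fun i =>
    GammaHodgeSectorNegative.isAlgebraic_of_isSemialgebraic_singleton (w₀ := fun _ => ξ univ i e₀)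
      (hgraph i ▸ hsa _ ((hmem _).2 ⟨univ, hS, Or.inl ⟨i, rfl⟩⟩))
  rcases hT' with ⟨j, rfl⟩ | ⟨j, rfl⟩
  · exact absurd (by rw [hgraph]; exact measure_singleton _) h0
  · have hSm : MeasurableSet {z : Fin (0 + 1) → ℝ | z 0 ∈ Icc (-1:ℝ) 1} := measurableSet_Icc.preimage (measurable_pi_apply 0)
    have hSf : volume {z : Fin (0 + 1) → ℝ | z 0 ∈ Icc (-1:ℝ) 1} ≠ ⊤ := by
      refine ((measure_mono fun z hz => ?_).trans_lt (isCompact_Icc (a := fun _ => (-1:ℝ)) (b := fun _ => 1)).measure_lt_top).ne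
      exact ⟨fun k => by rw [Fin.eq_zero k]; exact hz.1, fun k => by rw [Fin.eq_zero k]; exact hz.2⟩
    obtain ⟨hj0, hjl⟩ := KZ.ne_zero_and_ne_last_of_bandOver_subset hSm hSf MeasurableSet.univ (by simp [volume_pi]) (ξ univ) hsub
    refine ⟨_, _, hmono univ hS e₀ (mem_univ _) (Fin.pred_lt_castPred hj0 hjl), halg _, halg _, ?_⟩
    ext z
    rw [mem_bandOver_iff, bandLower_of_ne_zero _ _ hj0, bandUpper_of_ne_last _ _ hjl, EReal.coe_lt_coe_iff, EReal.coe_lt_coe_iff, hinit]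
    exact ⟨fun h => h.2, fun h => ⟨mem_univ _, h⟩⟩

/-- **Step (D): a smooth bounded band is one standard cell.** For `a < b` algebraic and `lo < hi`
`ℚ`-semialgebraic and `C¹` on `(a, b)`, the planar set `{a < x < b, lo x < y < hi x}` is congruent
in `planarGroup` to the standard cell of `g(u) = (b − a)(hi − lo)(a + (b − a)u)` (shear by `lo`,
`StackingShear.exists_shear_move`, then the affine move `((x − a)/(b − a), (b − a)y)`, `det = 1`),
and `g` is `ℚ`-semialgebraic, `C¹`, positive and integrable on `(0, 1)`. [folklore] -/
private theorem sbb {a b : ℝ} (hab : a < b) (ha : IsAlgebraic ℚ a) (hb : IsAlgebraic ℚ b)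
    {lo hi : ℝ → ℝ}
    (hlos : IsSemialgebraicFunOn ℚ {z : Fin 1 → ℝ | z 0 ∈ Ioo a b} fun z => lo (z 0))
    (hhis : IsSemialgebraicFunOn ℚ {z : Fin 1 → ℝ | z 0 ∈ Ioo a b} fun z => hi (z 0))
    (hloc : ContDiffOn ℝ 1 lo (Ioo a b)) (hhic : ContDiffOn ℝ 1 hi (Ioo a b))
    (hlt : ∀ x ∈ Ioo a b, lo x < hi x) (e : KZ.IntegralRep 2)
    (hed : e.domain = {p | p 0 ∈ Ioo a b ∧ lo (p 0) < p 1 ∧ p 1 < hi (p 0)})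
    (he1 : ∀ p ∈ e.domain, e.integrand p = 1) :
    ∃ (g : ℝ → ℝ) (c : KZ.IntegralRep 2),
      (IsSemialgebraicFunOn ℚ {z : Fin 1 → ℝ | z 0 ∈ Ioo (0:ℝ) 1} (fun z => g (z 0)) ∧
        ContDiffOn ℝ 1 g (Ioo (0:ℝ) 1) ∧ (∀ x ∈ Ioo (0:ℝ) 1, 0 < g x) ∧
        IntegrableOn g (Ioo (0:ℝ) 1)) ∧
      c.domain = {p : Fin 2 → ℝ | p 0 ∈ Ioo (0:ℝ) 1 ∧ 0 < p 1 ∧ p 1 < g (p 0)} ∧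
      (∀ p ∈ c.domain, c.integrand p = 1) ∧ KZ.of e - KZ.of c ∈ planarGroup := by
  -- shear down by `lo`
  obtain ⟨r', hr'd, hr'i, hcov⟩ := StackingShear.exists_shear_move hlos (hloc.differentiableOn one_ne_zero) e
    (fun p hp => by rw [hed] at hp; exact hp.1) he1
  have hr'1 : ∀ p ∈ r'.domain, r'.integrand p = 1 := fun p _ => hr'i p
  have hr'dom : ∀ q, q ∈ r'.domain ↔ q 0 ∈ Ioo a b ∧ 0 < q 1 ∧ q 1 < hi (q 0) - lo (q 0) := by
    intro q
    rw [hr'd, hed]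
    constructor
    · rintro ⟨p, ⟨h0, h1, h2⟩, rfl⟩
      simp only [Matrix.cons_val_zero, Matrix.cons_val_one, Matrix.cons_val_fin_one]
      exact ⟨h0, by linarith, by linarith⟩
    · rintro ⟨h0, h1, h2⟩
      exact ⟨![q 0, q 1 + lo (q 0)], ⟨by simpa using h0, by simp; linarith, by simp; linarith⟩, by ext i; fin_cases i <;> simp⟩
  -- the affine renormalisation `Ψ (x, y) = ((x - a)/d, d y)`, `d = b - a`
  set d := b - a
  have hd : 0 < d := sub_pos.2 hab
  have hda : IsAlgebraic ℚ d := hb.sub ha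
  set L : (Fin 2 → ℝ) →L[ℝ] (Fin 2 → ℝ) :=
    ContinuousLinearMap.pi ![d⁻¹ • ContinuousLinearMap.proj 0, d • ContinuousLinearMap.proj 1] with hL
  set Ψ : (Fin 2 → ℝ) → (Fin 2 → ℝ) := fun p => ![(p 0 - a) / d, d * p 1] with hΨ
  have hΨL : Ψ = fun p => L p + ![-a / d, 0] := by
    funext p; ext i; fin_cases i; (· simp [hΨ, hL]; ring); simp [hΨ, hL]
  have hdet : L.det = 1 := by
    rw [hL, ContinuousLinearMap.det, ← LinearMap.det_toMatrix', Matrix.det_fin_two]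
    simp [LinearMap.toMatrix'_apply, hd.ne']
  have hinj : InjOn Ψ r'.domain := by
    intro p _ q _ h
    have h0 : (p 0 - a) / d = (q 0 - a) / d := by simpa [hΨ] using congrFun h 0
    have h1 : d * p 1 = d * q 1 := by simpa [hΨ, hd.ne'] using congrFun h 1
    rw [div_left_inj' hd.ne', sub_left_inj] at h0
    ext i; fin_cases i; exacts [h0, mul_left_cancel₀ hd.ne' h1]
  have hsa : IsSemialgebraicMapOn ℚ r'.domain Ψ := by
    have hs := r'.isSemialgebraic_domain
    refine IsSemialgebraicMapOn.of_forall hs (Fin.forall_fin_two.2 ⟨?_, ?_⟩)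
    · exact (IsSemialgebraicFunOn.sub_holds (isSemialgebraicFunOn_apply hs 0) (isSemialgebraicFunOn_const_of_isAlgebraic hs ha)).div
        (isSemialgebraicFunOn_const_of_isAlgebraic hs hda) fun _ _ => hd.ne'
    · exact IsSemialgebraicFunOn.mul_holds (isSemialgebraicFunOn_const_of_isAlgebraic hs hda) (isSemialgebraicFunOn_apply hs 1)
  obtain ⟨c, hcd, hci, hcov2⟩ := cov_move r' hr'1 hsa (Φ' := fun _ => L)
    (fun p _ => by rw [hΨL]; exact (L.hasFDerivAt.add_const _).hasFDerivWithinAt) hinj (fun p _ => by simp [hdet])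
  -- the image is the standard cell of `g`
  set g : ℝ → ℝ := fun u => d * (hi (a + d * u) - lo (a + d * u)) with hg
  have haff : ∀ u ∈ Ioo (0:ℝ) 1, a + d * u ∈ Ioo a b := fun u hu => ⟨lt_add_of_pos_right _ (mul_pos hd hu.1), by nlinarith [hu.2]⟩
  have hcdom : c.domain = {p : Fin 2 → ℝ | p 0 ∈ Ioo (0:ℝ) 1 ∧ 0 < p 1 ∧ p 1 < g (p 0)} := by
    rw [hcd]
    ext q
    constructor
    · rintro ⟨p, hp, rfl⟩
      obtain ⟨h0, h1, h2⟩ := (hr'dom p).1 hp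
      have hx : a + d * ((p 0 - a) / d) = p 0 := by field_simp; ring
      simp only [hΨ, hg, mem_setOf_eq, Matrix.cons_val_zero, Matrix.cons_val_one, Matrix.cons_val_fin_one, hx, mem_Ioo]
      exact ⟨⟨div_pos (sub_pos.2 h0.1) hd, (div_lt_one hd).2 (by linarith [h0.2])⟩, mul_pos hd h1, mul_lt_mul_of_pos_left h2 hd⟩
    · rintro ⟨h0, h1, h2⟩
      refine ⟨![a + d * q 0, q 1 / d], (hr'dom _).2 ⟨by simpa using haff _ h0, by simp; positivity, ?_⟩, ?_⟩
      · simp only [Matrix.cons_val_one, Matrix.cons_val_fin_one, Matrix.cons_val_zero, hg] at h2 ⊢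
        rw [div_lt_iff₀ hd]; linarith
      · ext i; fin_cases i <;> simp [hΨ] <;> field_simp
  -- properties of `g`
  have h01 : IsSemialgebraic ℚ {z : Fin 1 → ℝ | z 0 ∈ Ioo (0:ℝ) 1} := by
    simpa using (isSemialgebraic_coord_Ioo 0 0 1).preimage_aeval (fun _ : Fin 2 => (MvPolynomial.X 0 : MvPolynomial (Fin 1) ℚ))
  have hK := fun {x : ℝ} (hx : IsAlgebraic ℚ x) => isSemialgebraicFunOn_const_of_isAlgebraic h01 hx
  have hgs : IsSemialgebraicFunOn ℚ {z : Fin 1 → ℝ | z 0 ∈ Ioo (0:ℝ) 1} fun z => g (z 0) :=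
    IsSemialgebraicFunOn.mul_holds (hK hda) (IsSemialgebraicFunOn.comp_isSemialgebraicMapOn_holds
      (IsSemialgebraicFunOn.sub_holds hhis hlos) (IsSemialgebraicMapOn.of_forall h01 fun _ => IsSemialgebraicFunOn.add_holds
        (hK ha) (IsSemialgebraicFunOn.mul_holds (hK hda) (isSemialgebraicFunOn_apply h01 0))) fun z hz => haff _ hz)
  have hgc : ContDiffOn ℝ 1 g (Ioo 0 1) := contDiffOn_const.mul
    ((hhic.sub hloc).comp (contDiff_const.add (contDiff_const.mul contDiff_id)).contDiffOn fun u hu => haff u hu)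
  have hgpos : ∀ u ∈ Ioo (0:ℝ) 1, 0 < g u := fun u hu => mul_pos hd (sub_pos.2 (hlt _ (haff u hu)))
  have hgm : AEStronglyMeasurable g (volume.restrict (Ioo 0 1)) := hgc.continuousOn.aestronglyMeasurable measurableSet_Ioo
  have hgi : IntegrableOn g (Ioo 0 1) := by
    refine ⟨hgm, (hasFiniteIntegral_iff_ofReal ((ae_restrict_mem measurableSet_Ioo).mono fun u hu => (hgpos u hu).le)).2 ?_⟩
    rw [← volume_cell measurableSet_Ioo hgm.aemeasurable, ← hcdom]
    exact (KZ.volume_ne_top_of_integrand_one c fun p _ => by rw [hci]).lt_top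
  refine ⟨g, c, ⟨hgs, hgc, hgpos, hgi⟩, hcdom, fun p _ => by rw [hci], ?_⟩
  simpa using add_mem (of_sub_of_mem_planarGroup_of_cov he1 hr'1 hcov) hcov2

/-- **Cutting a planar set along the cylinders** over a finite partition of the line (iterated
rule 1a, `PlanarCompilerProof.of_sub_sum_mem_planarGroup`). [folklore] -/
private theorem cylcut (r : KZ.IntegralRep 2) (hr1 : ∀ p ∈ r.domain, r.integrand p = 1)
    (𝒮 : Finset (Set (Fin 1 → ℝ))) (hpart : Setoid.IsPartition (𝒮 : Set (Set (Fin 1 → ℝ))))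
    (hsa : ∀ S ∈ 𝒮, IsSemialgebraic ℚ S) :
    ∃ R : {S // S ∈ 𝒮} → KZ.IntegralRep 2,
      (∀ S, (R S).domain = r.domain ∩ {z | Fin.init z ∈ (S : Set (Fin 1 → ℝ))}) ∧
      (∀ S, ∀ p ∈ (R S).domain, (R S).integrand p = 1) ∧
      KZ.of r - ∑ S ∈ 𝒮.attach, KZ.of (R S) ∈ planarGroup := by
  refine ⟨fun S => r.restrict _ (r.isSemialgebraic_domain.inter (hsa S S.2).setOf_init_mem) inter_subset_left, fun S => rfl,
    fun S p hp => hr1 p hp.1, ?_⟩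
  refine of_sub_sum_mem_planarGroup 𝒮.attach r hr1 (fun S => r.domain ∩ {z | Fin.init z ∈ (S : Set (Fin 1 → ℝ))}) _
    (fun S _ => r.isSemialgebraic_domain.inter (hsa S S.2).setOf_init_mem) (fun S _ => inter_subset_left)
    (fun S _ S' _ hne => ?_) ?_ (fun S _ => rfl) (fun S _ p hp => hr1 p hp.1)
  · exact Set.disjoint_left.2 fun z hz hz' => (hpart.pairwiseDisjoint S.2 S'.2 fun h => hne (Subtype.ext h)).ne_of_mem hz.2 hz'.2 rfl
  · rw [Set.sdiff_eq_empty.2 fun z hz => ?_, measure_empty]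
    have hcov : Fin.init z ∈ ⋃₀ (𝒮 : Set (Set (Fin 1 → ℝ))) := by rw [hpart.sUnion_eq_univ]; exact mem_univ _
    obtain ⟨S, hS, hzS⟩ := mem_sUnion.1 hcov
    exact mem_iUnion₂.2 ⟨⟨S, hS⟩, Finset.mem_attach _ _, hz, hzS⟩

/-- **Steps (B)–(C): bounded reading.** A planar integrand-`1` set inside the slab `{|x| ≤ 1}` is
congruent in `planarGroup` to a finite sum of standard cells: cylindrical decomposition adapted to
the set (`exists_fibre_eq`), cuts along the cylinders, null cells and graphs discarded, inner
bands kept; each band is cut again over a decomposition of the line adapted to the common smooth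
locus of its two sections (`KZ.exists_isOpen_contDiffOn`), leaving null pieces and smooth bands
over algebraic intervals (`level_one`), each ONE standard cell by `sbb`. [folklore] -/
private theorem brd (r : KZ.IntegralRep 2) (hr1 : ∀ p ∈ r.domain, r.integrand p = 1)
    (hsl : ∀ p ∈ r.domain, p 0 ∈ Icc (-1:ℝ) 1) :
    ∃ L : List ((ℝ → ℝ) × KZ.IntegralRep 2), (∀ gc ∈ L,
      (IsSemialgebraicFunOn ℚ {z : Fin 1 → ℝ | z 0 ∈ Set.Ioo (0 : ℝ) 1} (fun z => gc.1 (z 0)) ∧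
        ContDiffOn ℝ 1 gc.1 (Set.Ioo (0 : ℝ) 1) ∧ (∀ x ∈ Set.Ioo (0 : ℝ) 1, 0 < gc.1 x) ∧
        IntegrableOn gc.1 (Set.Ioo (0 : ℝ) 1)) ∧
      gc.2.domain = {p : Fin 2 → ℝ | p 0 ∈ Set.Ioo (0 : ℝ) 1 ∧ 0 < p 1 ∧ p 1 < gc.1 (p 0)} ∧
      ∀ p ∈ gc.2.domain, gc.2.integrand p = 1) ∧
      KZ.of r - (L.map fun gc => KZ.of gc.2).sum ∈ planarGroup := by
  classical
  obtain ⟨𝒮, l, ξ, hcd, -, hξ, hmono, hcells, hfib⟩ := IsSemialgebraic.exists_cylindricalDecomposition.exists_fibre_eq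
    (IsSemialgebraic.exists_cylindricalDecomposition_holds (k := ℚ)) r.isSemialgebraic_domain
  have hSm : MeasurableSet r.domain := KZ.IntegralRep.measurableSet_domain_holds r
  have hfin := KZ.volume_ne_top_of_integrand_one r hr1
  have hinit : ∀ p : Fin 2 → ℝ, Fin.init p = fun _ => p 0 := fun p => funext fun k => by rw [Fin.eq_zero k]; rfl
  have hz1 : ∀ z : Fin 1 → ℝ, (fun _ => z 0) = z := fun z => funext fun k => by rw [Fin.eq_zero k]
  -- (B) cut along the cylinders over the cells
  obtain ⟨R, hRd, hR1, eR⟩ := cylcut r hr1 𝒮 hcd.isPartition hcd.isSemialgebraic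
  refine sc_congr eR (sc_sum _ _ fun S _ => ?_)
  have hSsa := hcd.isSemialgebraic S S.2
  have hCm : MeasurableSet (S : Set (Fin 1 → ℝ)) := IsSemialgebraic.measurableSet_holds hSsa
  by_cases hS0 : volume (S : Set (Fin 1 → ℝ)) = 0
  · exact sc_zero (of_mem_planarGroup_of_volume_eq_zero _ (hR1 S) (by
      rw [hRd]; exact measure_mono_null inter_subset_right (KZ.volume_setOf_init_mem_eq_zero hS0)))
  obtain ⟨G, B, -, hBsub, hfibS⟩ := hfib S S.2
  have hinner := fun j hj => KZ.ne_zero_and_ne_last_of_bandOver_subset hSm hfin hCm hS0 (ξ S) (hBsub j hj)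
  -- split the piece over `S` into its (inner) bands
  have hOb : ∀ j : {j // j ∈ B}, ∃ Ob : KZ.IntegralRep 2, Ob.domain = bandOver S (ξ S) j ∧ Ob.integrand = fun _ => 1 :=
    fun j => KZ.exists_oneRep ((hcells S S.2).2 j) ((measure_mono (hBsub j j.2)).trans_lt hfin.lt_top).ne
  choose Ob hObd hObi using hOb
  have eB : KZ.of (R S) - ∑ j ∈ B.attach, KZ.of (Ob j) ∈ planarGroup := by
    refine of_sub_sum_mem_planarGroup B.attach (R S) (hR1 S) (fun j => bandOver S (ξ S) j) Ob (fun j _ => (hcells S S.2).2 j)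
      (fun j _ z hz => ?_) (fun j _ j' _ hne => ?_) ?_ (fun j _ => hObd j) (fun j _ p _ => by rw [hObi])
    · rw [hRd]; exact ⟨hBsub j j.2 hz, hz.1⟩
    · exact Set.disjoint_left.2 fun z hz hz' => (Set.disjoint_left.1 (KZ.disjoint_bandFibre (ξ S) (hmono S S.2 _ hz.1)
        fun h => hne (Subtype.ext h))) ⟨hz.2.1, hz.2.2⟩ ⟨hz'.2.1, hz'.2.2⟩
    · refine measure_mono_null (fun z hz => ?_) ((measure_biUnion_null_iff G.countable_toSet).2
        fun j _ => KZ.volume_graph_eq_zero (hξ S S.2 j))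
      rw [hRd] at hz
      obtain ⟨⟨hzr, hzS⟩, hzU⟩ := hz
      have ht : z (Fin.last 1) ∈ {t : ℝ | (Fin.snoc (Fin.init z) t : Fin 2 → ℝ) ∈ r.domain} := by
        show Fin.snoc (Fin.init z) (z (Fin.last 1)) ∈ r.domain
        rw [Fin.snoc_init_self]; exact hzr
      rw [hfibS _ hzS, mem_union, mem_iUnion₂, mem_iUnion₂] at ht
      rcases ht with ⟨j, hj, hjt⟩ | ⟨j, hj, hjt⟩
      · exact mem_iUnion₂.2 ⟨j, hj, hzS, hjt⟩
      · exact (hzU (mem_iUnion₂.2 ⟨⟨j, hj⟩, Finset.mem_attach _ _, hzS, hjt.1, hjt.2⟩)).elim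
  refine sc_congr eB (sc_sum _ _ fun j _ => ?_)
  -- (C) one inner band: smooth loci of its two sections, and a decomposition adapted to them
  obtain ⟨h0, hl⟩ := hinner j j.2
  set lo := ξ S (j.1.pred h0)
  set hi := ξ S (j.1.castPred hl)
  have hlt : ∀ x ∈ (S : Set (Fin 1 → ℝ)), lo x < hi x := fun x hx => hmono S S.2 x hx (Fin.pred_lt_castPred h0 hl)
  have hband : ∀ p, p ∈ (Ob j).domain ↔ Fin.init p ∈ (S : Set (Fin 1 → ℝ)) ∧ lo (Fin.init p) < p 1 ∧ p 1 < hi (Fin.init p) :=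
    fun p => by
    rw [hObd, mem_bandOver_iff, bandLower_of_ne_zero _ _ h0, bandUpper_of_ne_last _ _ hl, EReal.coe_lt_coe_iff,
      EReal.coe_lt_coe_iff]; rfl
  have hObr : (Ob j).domain ⊆ r.domain := (hObd j).symm ▸ hBsub j j.2
  obtain ⟨G₁, hG₁S, -, hG₁sa, hG₁c, -, hG₁0⟩ := KZ.exists_isOpen_contDiffOn hSsa (hξ S S.2 (j.1.pred h0))
  obtain ⟨G₂, hG₂S, -, hG₂sa, hG₂c, -, hG₂0⟩ := KZ.exists_isOpen_contDiffOn hSsa (hξ S S.2 (j.1.castPred hl))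
  obtain ⟨𝒯, h𝒯, hcov⟩ := IsSemialgebraic.exists_cylindricalDecomposition_holds (k := ℚ) {G₁ ∩ G₂} (by simpa using hG₁sa.inter hG₂sa)
  obtain ⟨𝒞, h𝒞, hU⟩ := hcov _ (Finset.mem_singleton_self _)
  obtain ⟨RT, hRTd, hRT1, eT⟩ := cylcut (Ob j) (fun p _ => by rw [hObi]) 𝒯 h𝒯.isPartition h𝒯.isSemialgebraic
  refine sc_congr eT (sc_sum _ _ fun T _ => ?_)
  by_cases hgood : T.1 ∈ 𝒞 ∧ volume (T : Set (Fin 1 → ℝ)) ≠ 0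
  · have hTU : (T : Set (Fin 1 → ℝ)) ⊆ G₁ ∩ G₂ := hU ▸ subset_sUnion_of_mem hgood.1
    have hTS : (T : Set (Fin 1 → ℝ)) ⊆ S := fun z hz => hG₁S (hTU hz).1
    have hTsl : (T : Set (Fin 1 → ℝ)) ⊆ {z | z 0 ∈ Icc (-1:ℝ) 1} := fun z hz => by
      have hzS := hTS hz
      have hp : (![z 0, (lo z + hi z) / 2] : Fin 2 → ℝ) ∈ (Ob j).domain := by
        rw [hband, hinit]
        simp only [Matrix.cons_val_zero, Matrix.cons_val_one, Matrix.cons_val_fin_one, hz1]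
        exact ⟨hzS, by linarith [hlt z hzS], by linarith [hlt z hzS]⟩
      simpa using hsl _ (hObr hp)
    obtain ⟨a, b, hab, ha, hb, hT⟩ := level_one h𝒯 T.2 hgood.2 hTsl
    have hTsa : IsSemialgebraic ℚ {z : Fin 1 → ℝ | z 0 ∈ Ioo a b} := hT ▸ h𝒯.isSemialgebraic _ T.2
    have hT' : ∀ x ∈ Ioo a b, (fun _ => x : Fin 1 → ℝ) ∈ (T : Set (Fin 1 → ℝ)) := fun x hx => by rw [hT]; exact hx
    have hTS' : {z : Fin 1 → ℝ | z 0 ∈ Ioo a b} ⊆ S := hT ▸ hTS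
    have hsec : ∀ {G : Set (Fin 1 → ℝ)} {f : (Fin 1 → ℝ) → ℝ}, (T : Set (Fin 1 → ℝ)) ⊆ G →
        IsSemialgebraicFunOn ℚ (S : Set (Fin 1 → ℝ)) f → ContDiffOn ℝ ∞ f G →
        IsSemialgebraicFunOn ℚ {z : Fin 1 → ℝ | z 0 ∈ Ioo a b} (fun z => f fun _ => z 0) ∧
          ContDiffOn ℝ 1 (fun x => f fun _ => x) (Ioo a b) := fun hTG hf hfc =>
      ⟨((hf.mono hTS' hTsa).congr fun z _ => by rw [hz1]), (hfc.of_le (by exact_mod_cast le_top)).comp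
        (contDiff_pi.2 fun _ => contDiff_id).contDiffOn fun x hx => hTG (hT' x hx)⟩
    obtain ⟨hlos, hloc⟩ := hsec (fun z hz => (hTU hz).1) (hξ S S.2 _) hG₁c
    obtain ⟨hhis, hhic⟩ := hsec (fun z hz => (hTU hz).2) (hξ S S.2 _) hG₂c
    obtain ⟨g, c, hg, hcd, hc1, hmem⟩ := sbb hab ha hb hlos hhis hloc hhic (fun x hx => hlt _ (hTS (hT' x hx))) (RT T) (by
        ext p
        rw [hRTd, mem_inter_iff, hband, mem_setOf_eq, mem_setOf_eq, hT, mem_setOf_eq, hinit]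
        exact ⟨fun ⟨⟨_, h1, h2⟩, h0⟩ => ⟨h0, h1, h2⟩, fun ⟨h0, h1, h2⟩ => ⟨⟨hTS' h0, h1, h2⟩, h0⟩⟩) (hRT1 T)
    exact ⟨[(g, c)], List.forall_mem_singleton.2 ⟨hg, hcd, hc1⟩, by simpa using hmem⟩
  · refine sc_zero (of_mem_planarGroup_of_volume_eq_zero _ (hRT1 T) ?_)
    rw [hRTd]
    by_cases hT𝒞 : T.1 ∈ 𝒞
    · exact measure_mono_null inter_subset_right (KZ.volume_setOf_init_mem_eq_zero (by by_contra h; exact hgood ⟨hT𝒞, h⟩))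
    · refine measure_mono_null (fun p hp => ?_) (KZ.volume_setOf_init_mem_eq_zero (measure_union_null hG₁0 hG₂0))
      have hpS : Fin.init p ∈ (S : Set (Fin 1 → ℝ)) := ((hband p).1 hp.1).1
      have hpU : Fin.init p ∉ G₁ ∩ G₂ := fun h => by
        rw [← hU] at h
        obtain ⟨T', hT', hpT'⟩ := mem_sUnion.1 h
        obtain ⟨b, -, huniq⟩ := h𝒯.isPartition.2 (Fin.init p)
        exact hT𝒞 (((huniq T.1 ⟨T.2, hp.2⟩).trans (huniq T' ⟨h𝒞 hT', hpT'⟩).symm) ▸ hT')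
      show Fin.init p ∈ ((S : Set (Fin 1 → ℝ)) \ G₁) ∪ (S \ G₂)
      by_contra h
      simp only [mem_union, mem_sdiff, not_or, not_and, not_not] at h
      exact hpU ⟨h.1 hpS, h.2 hpS⟩

/-- **Stub 1 (cell reading).** Every planar set (integrand `1`) is congruent modulo the planar
set-chain group to a finite sum of standard cells `{0 < x < 1, 0 < y < g x}` with `g`
`ℚ`-semialgebraic, `C¹`, positive and integrable on `(0,1)`. [folklore] -/
theorem stub_cellReading :
    ∀ (r : KZ.IntegralRep 2), (∀ p ∈ r.domain, r.integrand p = 1) →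
      ∃ (n : ℕ) (g : Fin n → ℝ → ℝ) (c : Fin n → KZ.IntegralRep 2),
        (∀ i, IsSemialgebraicFunOn ℚ {z : Fin 1 → ℝ | z 0 ∈ Set.Ioo (0 : ℝ) 1} (fun z => g i (z 0)) ∧
          ContDiffOn ℝ 1 (g i) (Set.Ioo (0 : ℝ) 1) ∧ (∀ x ∈ Set.Ioo (0 : ℝ) 1, 0 < g i x) ∧
          IntegrableOn (g i) (Set.Ioo (0 : ℝ) 1)) ∧
        (∀ i, (c i).domain = {p : Fin 2 → ℝ | p 0 ∈ Set.Ioo (0 : ℝ) 1 ∧ 0 < p 1 ∧ p 1 < g i (p 0)} ∧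
          ∀ p ∈ (c i).domain, (c i).integrand p = 1) ∧
        KZ.of r - ∑ i, KZ.of (c i) ∈ planarGroup := by
  intro r hr
  obtain ⟨r₁, r₂, h₁, h₂, hs₁, hs₂, hA⟩ := stepA r hr
  obtain ⟨L, hL, hm⟩ := sc_add (brd r₁ h₁ hs₁) (brd r₂ h₂ hs₂)
  refine ⟨L.length, fun i => (L[(i : ℕ)]).1, fun i => (L[(i : ℕ)]).2, fun i => (hL _ (List.getElem_mem _)).1,
    fun i => (hL _ (List.getElem_mem _)).2, ?_⟩
  have hsum : ∑ i : Fin L.length, KZ.of (L[(i : ℕ)]).2 = (L.map fun gc => KZ.of gc.2).sum := by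
    rw [← List.sum_ofFn]; exact congrArg List.sum (List.ofFn_getElem_eq_map L fun gc => KZ.of gc.2)
  rw [hsum]; convert add_mem hA hm using 1; abel

end Summit.KontsevichZagierPeriods.SymplecticScissors.MordellWeil

end
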